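import Summits.QuantumAdvantage.QuantumAdvantage.Theorems.RankDialI3
import HarnessLib

/-!
# RankDial (K1) — §26 the JUNTA-RANK grade `JRankLE` ⊇ wide rank ⊇ perturbed span `PRankLE`; class sums `≤ p^D·2^ℓ·e^{−η_p ℓ/4^{s+1}}`; perturb fibre/window theorems

TARGET BY NAME (cell decomp-qadv, RESIDUAL MODE): item stmt-QuantumAdvantage-23109
`Summit.QuantumAdvantage.QuantumAdvantage.Theses.OddPrimeWalk.ManyReadersSqrtOdd`, through rung R5 = `AdviceFreeQNC0.WalkHardFLinSel p`.
This file SUPPORTS the item (`--supports`); it does not close it.  Declaration bodies are byte-identical to the cell node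
«PerturbDial» (decomp-qadv lens-1, generation 26, part K; node file RankDialK.lean = node «BiasDial» RankDialJ.lean (parts G, H, I, J =
tree files RankDialG1–G2, H1–H3, I1–I3, J1) followed by §26–§27), cut into ≤ 400-line parts
K1 (§26 the junta-rank grade `JRankLE`, the perturbed-span grade `PRankLE`, the class-sum bound and the fibre/window theorems; imports I3 —
it does not use part J) → K2 (§27 pieces: `WindowJSpanLinSel` PROVED `p ≠ 3` ⊇ span law, residual `WindowJSpreadLinSel`, `perturb_dial`).
See the node file for the mechanism summary.
-/

set_option linter.dupNamespace false
set_option autoImplicit false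

noncomputable section
open Classical

namespace Summit.QuantumAdvantage.QuantumAdvantage.Theorems.RankDial

open Finset
open Summit.QuantumAdvantage.AdviceFreeQNC0
open Literature.Computability.MetaComplexity Literature.Computability.MetaComplexity.Smolensky

/-! ### §26 (part K «PerturbDial») The JUNTA-RANK grade: wide cuts answering through `D` linear forms AND `≤ s` window bits

PART K (decomp-qadv lens-1 «grading / quantitative ladder», generation 26).  Part I charged the wide cuts their RANK:
they had to answer through `D` linear forms `Φ·v` of the window.  Part K lets every wide cut ALSO read `≤ s` window bits of
its own (`JRankLE`, the junta-rank grade): on each of the `p^D` level sets `{Φ·v = x}` the wide cuts are then `s`-juntas,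
hence of `𝔽₂`-degree `≤ s` like the narrow cuts, and the level-set indicator is an average of characters (§22), so the
Viola–Wigderson + non-resonance bound of part H survives level set by level set at total cost `p^D` — the SAME budget as the
span law.  The motivating instance is the PERTURBED SPAN (`PRankLE`): every wide window form lies in a `D`-dimensional space of
forms up to a perturbation supported on `≤ s` coordinates; e.g. the family `λ_g = 𝟙 + (t−1)·e_{i_g}` (one wide cut per site:
𝔽₂-degree `ℓ`, wide rank `ℓ`, outside parts H and I) has perturbed rank ONE and is discharged here.  Pieces in §27. -/

/-- **THE JUNTA-RANK GRADE** `JRankLE p y lam s r`: there are `d ≤ r` linear forms `Φ₁…Φ_d` of the window such that every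
cut of window support `> s` answers, on every outside fibre, through the values `(Φ_k · v)_k` AND at most `s` further window
bits (a set `S` with `#S ≤ s`, depending on the cut and the fibre).  [`WRankLE ⟹ JRankLE` (`S = ∅`); `PRankLE ⟹ JRankLE`.] -/
def JRankLE (p : ℕ) [Fact p.Prime] {L ℓ R : ℕ} (y : Fin (L + ℓ + R + 1) → (Fin (L + ℓ + R) → Bool) → Bool)
    (lam : Fin (L + ℓ + R + 1) → Fin (L + ℓ + R) → ZMod p) (s r : ℕ) : Prop :=
  ∃ d : ℕ, d ≤ r ∧ ∃ Φ : Fin d → Fin ℓ → ZMod p,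
    ∀ g : Fin (L + ℓ + R + 1), s < (wsupp lam g).card → ∀ (a : Fin L → Bool) (b : Fin R → Bool),
      ∃ S : Finset (Fin ℓ), S.card ≤ s ∧ ∃ T : (Fin d → ZMod p) → (Fin ℓ → Bool) → Bool,
        (∀ x, ∀ v w : Fin ℓ → Bool, (∀ i ∈ S, v i = w i) → T x v = T x w) ∧
        ∀ v : Fin ℓ → Bool, y g (glue3 a v b) = T (fun k => ∑ j, if v j then Φ k j else 0) v

/-- **THE PERTURBED-SPAN GRADE** `PRankLE p lam s r` (a property of the representation alone): there are `d ≤ r` forms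
`Φ₁…Φ_d` such that the window form of every cut of window support `> s` agrees with some `𝔽_p`-combination `Σ_k t_k Φ_k`
outside at most `s` coordinates. -/
def PRankLE (p : ℕ) [Fact p.Prime] {L ℓ R : ℕ} (lam : Fin (L + ℓ + R + 1) → Fin (L + ℓ + R) → ZMod p)
    (s r : ℕ) : Prop :=
  ∃ d : ℕ, d ≤ r ∧ ∃ Φ : Fin d → Fin ℓ → ZMod p,
    ∀ g : Fin (L + ℓ + R + 1), s < (wsupp lam g).card → ∃ t : Fin d → ZMod p,
      (univ.filter fun j : Fin ℓ => lamW lam g j ≠ ∑ k, t k * Φ k j).card ≤ s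

section PerturbFibre
variable {p : ℕ} [Fact p.Prime] {L ℓ R : ℕ} (c : ℕ) (y : Fin (L + ℓ + R + 1) → (Fin (L + ℓ + R) → Bool) → Bool)
  (lam : Fin (L + ℓ + R + 1) → Fin (L + ℓ + R) → ZMod p) (rr : Fin (L + ℓ + R + 1) → ZMod p)

/-- `linPart` of a pointwise difference of forms. -/
theorem linPart_sub_fun (μ ν : Fin ℓ → ZMod p) (v : Fin ℓ → Bool) :
    linPart (fun j => μ j - ν j) v = linPart μ v - linPart ν v := by
  simp only [linPart, ← Finset.sum_sub_distrib]
  refine Finset.sum_congr rfl fun j _ => ?_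
  split_ifs <;> simp

/-- `linPart` of an `𝔽_p`-combination of forms. -/
theorem linPart_linComb {d : ℕ} (t : Fin d → ZMod p) (Φ : Fin d → Fin ℓ → ZMod p) (v : Fin ℓ → Bool) :
    linPart (fun j => ∑ k, t k * Φ k j) v = ∑ k, t k * linPart (Φ k) v := by
  unfold linPart
  rw [show (∑ k, t k * ∑ j, if v j then Φ k j else 0) = ∑ j, ∑ k, t k * (if v j then Φ k j else 0) by
    simp only [Finset.mul_sum]; exact Finset.sum_comm]
  refine Finset.sum_congr rfl fun j _ => ?_
  by_cases hj : v j <;> simp [hj]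

/-- The wide-rank grade is a junta-rank grade (no extra bits). -/
theorem jRankLE_of_wRankLE {s r : ℕ} (h : WRankLE p y lam s r) : JRankLE p y lam s r := by
  obtain ⟨d, hd, Φ, hΦ⟩ := h
  refine ⟨d, hd, Φ, fun g hg a b => ?_⟩
  obtain ⟨T, hT⟩ := hΦ g hg a b
  exact ⟨∅, by simp, fun x _ => T x, fun _ _ _ _ => rfl, hT⟩

/-- **Perturbed span ⟹ junta rank** (linear representation): on the level set `{Φ·v = x}` the test
`λ_g·v = ρ` reads `δ_g·v = ρ − Σ_k t_k x_k` with `δ_g = λ_g − Σ_k t_k Φ_k` supported on `≤ s` coordinates. -/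
theorem jRankLE_of_pRankLE (hyl : ∀ g u, y g u = decide ((∑ i, if u i then lam g i else 0) = rr g))
    {s r : ℕ} (h : PRankLE p lam s r) : JRankLE p y lam s r := by
  obtain ⟨d, hd, Φ, hΦ⟩ := h
  refine ⟨d, hd, Φ, fun g hg a b => ?_⟩
  obtain ⟨t, ht⟩ := hΦ g hg
  refine ⟨univ.filter (fun j : Fin ℓ => lamW lam g j ≠ ∑ k, t k * Φ k j), ht,
    fun x v => decide (linPart (fun j => lamW lam g j - ∑ k, t k * Φ k j) v =
      rhoW lam rr a b g - ∑ k, t k * x k), ?_, ?_⟩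
  · intro x v w hvw
    have hs : linPart (fun j => lamW lam g j - ∑ k, t k * Φ k j) v =
        linPart (fun j => lamW lam g j - ∑ k, t k * Φ k j) w := by
      refine Finset.sum_congr rfl fun j _ => ?_
      by_cases hj : lamW lam g j ≠ ∑ k, t k * Φ k j
      · rw [hvw j (Finset.mem_filter.2 ⟨Finset.mem_univ _, hj⟩)]
      · have h0 : lamW lam g j - ∑ k, t k * Φ k j = 0 := sub_eq_zero.2 (not_not.1 hj)
        simp [h0]
    show decide (linPart (fun j => lamW lam g j - ∑ k, t k * Φ k j) v = rhoW lam rr a b g - ∑ k, t k * x k) =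
      decide (linPart (fun j => lamW lam g j - ∑ k, t k * Φ k j) w = rhoW lam rr a b g - ∑ k, t k * x k)
    rw [hs]
  · intro v
    rw [linSel_glue3 y lam rr hyl g a v b]
    show decide (linPart (lamW lam g) v = rhoW lam rr a b g) =
      decide (linPart (fun j => lamW lam g j - ∑ k, t k * Φ k j) v =
        rhoW lam rr a b g - ∑ k, t k * linPart (Φ k) v)
    rw [linPart_sub_fun, linPart_linComb]
    simp only [sub_left_inj]

/-- The recorded hard instance of parts H/I — wide window forms `t_g·β + (≤ s-sparse)` for ONE form `β`, e.g.
`𝟙 + (t−1)e_{i_g}` — has perturbed rank one. -/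
theorem pRankLE_one_of_near_colinear (s : ℕ) (β : Fin ℓ → ZMod p)
    (h : ∀ g : Fin (L + ℓ + R + 1), s < (wsupp lam g).card → ∃ t : ZMod p,
      (univ.filter fun j : Fin ℓ => lamW lam g j ≠ t * β j).card ≤ s) :
    PRankLE p lam s 1 := by
  refine ⟨1, le_rfl, fun _ => β, fun g hg => ?_⟩
  obtain ⟨t, ht⟩ := h g hg
  exact ⟨fun _ => t, by simpa using ht⟩

/-- **THE CLASS-SUM BOUND UNDER THE JUNTA-RANK GRADE** (`p ≠ 3`): if the wide cuts answer through `≤ D` linear forms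
and `≤ s` own bits on the fibre, then for every class `r`, `‖Σ_v (−1)^{classPar_r(v)} ω^{|v|}‖ ≤ p^D·2^ℓ·exp(−η_p ℓ/4^{s+1})`.
Proof: split the wide product over the `p^d` level sets of `Φ` (`comp_eq_sum_prod_indC`); on each level set the wide
signs form an `𝔽₂`-polynomial of degree `≤ s` (junta lemma), the level-set indicator costs nothing
(`norm_sum_mul_prod_indC_le`), and `norm_twisted_narrow_le` bounds each of the `p^d` pieces. -/
theorem norm_classSum_le_jrank (hp3 : p ≠ 3)
    (hyl : ∀ g u, y g u = decide ((∑ i, if u i then lam g i else 0) = rr g))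
    (a : Fin L → Bool) (b : Fin R → Bool) (r : ℕ) {s D : ℕ} (hJR : JRankLE p y lam s D) :
    ‖∑ v : Fin ℓ → Bool, GowersCube.signChar (classPar c y a b r v) * omega3 ^ wt v‖ ≤
      (p : ℝ) ^ D * (2 ^ ℓ * Real.exp (-(etaP p * ℓ / 4 ^ (s + 1)))) := by
  classical
  obtain ⟨d, hd, Φ, hΦ⟩ := hJR
  set Gr := univ.filter (fun g : Fin (L + ℓ + R + 1) => gapChar ℓ c a b g.val r % 3 ≠ 0) with hGr
  set Wr := Gr.filter (fun g => s < (wsupp lam g).card) with hWr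
  set Nr := Gr.filter (fun g => ¬ s < (wsupp lam g).card) with hNr
  set Qn : CubeFn (ZMod 2) ℓ := ∑ g ∈ Nr, fireFn y a b g with hQn_def
  have hQn : Qn ∈ lowDeg (ZMod 2) ℓ s := Submodule.sum_mem _ fun g hg =>
    lowDeg_mono (not_lt.1 (Finset.mem_filter.1 hg).2) (fireFn_mem_lowDeg_wsupp y lam rr hyl g a b)
  have hsplit : classPar c y a b r = (∑ g ∈ Wr, fireFn y a b g) + Qn := by
    rw [hQn_def, hWr, hNr, Finset.sum_filter_add_sum_filter_not, hGr]
    rfl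
  -- the wide cuts answer through Φ and ≤ s own bits on this fibre
  have key : ∀ g : Fin (L + ℓ + R + 1), ∃ S : Finset (Fin ℓ), ∃ T : (Fin d → ZMod p) → (Fin ℓ → Bool) → Bool,
      g ∈ Wr → (S.card ≤ s ∧ (∀ x, ∀ v w : Fin ℓ → Bool, (∀ i ∈ S, v i = w i) → T x v = T x w) ∧
        ∀ v, y g (glue3 a v b) = T (fun k => linPart (Φ k) v) v) := by
    intro g
    by_cases hg : g ∈ Wr
    · obtain ⟨S, hS, T, hT, hfire⟩ := hΦ g (Finset.mem_filter.1 hg).2 a b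
      exact ⟨S, T, fun _ => ⟨hS, hT, hfire⟩⟩
    · exact ⟨∅, fun _ _ => false, fun h => absurd h hg⟩
  choose Sg Tg hkey using key
  -- level-set polynomials of the wide cuts
  let P : (Fin d → ZMod p) → CubeFn (ZMod 2) ℓ := fun x =>
    ∑ g ∈ Wr, fun v => if Tg g x v = true then (1 : ZMod 2) else 0
  have hP : ∀ x, P x ∈ lowDeg (ZMod 2) ℓ s := fun x =>
    Submodule.sum_mem _ fun g hg => lowDeg_mono (hkey g hg).1
      (junta_mem_lowDeg (Sg g) _ fun v w hvw => by
        show (if Tg g x v = true then (1 : ZMod 2) else 0) = if Tg g x w = true then 1 else 0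
        rw [(hkey g hg).2.1 x v w hvw])
  have hFP : ∀ x v, (∏ g ∈ Wr, if Tg g x v = true then (-1 : ℂ) else 1) = GowersCube.signChar (P x v) := by
    intro x v
    show _ = GowersCube.signChar ((∑ g ∈ Wr, fun v => if Tg g x v = true then (1 : ZMod 2) else 0) v)
    rw [Finset.sum_apply, signChar_finset_sum]
    refine Finset.prod_congr rfl fun g _ => ?_
    by_cases h : Tg g x v = true <;> simp [h]
  have hsgn : ∀ v, GowersCube.signChar (classPar c y a b r v) =
      GowersCube.signChar (Qn v) * ∏ g ∈ Wr, (if Tg g (fun k => linPart (Φ k) v) v = true then (-1 : ℂ) else 1) := by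
    intro v
    rw [hsplit, Pi.add_apply, GowersCube.signChar_add, Finset.sum_apply, signChar_finset_sum, mul_comm]
    congr 1
    refine Finset.prod_congr rfl fun g hg => ?_
    rw [signChar_fireFn_eq_ite, (hkey g hg).2.2 v]
  have hcomp : ∀ v, (∏ g ∈ Wr, if Tg g (fun k => linPart (Φ k) v) v = true then (-1 : ℂ) else 1) =
      ∑ x : Fin d → ZMod p, (∏ g ∈ Wr, if Tg g x v = true then (-1 : ℂ) else 1) * ∏ k, indC (Φ k) (x k) v := by
    intro v
    have h := comp_eq_sum_prod_indC Φ (fun x => ∏ g ∈ Wr, (if Tg g x v = true then (-1 : ℂ) else 1)) v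
    simpa only using h
  have hpt : ∀ v, GowersCube.signChar (classPar c y a b r v) * omega3 ^ wt v =
      ∑ x : Fin d → ZMod p, (GowersCube.signChar ((Qn + P x) v) * omega3 ^ wt v) *
        ∏ k, indC (Φ k) (x k) v := by
    intro v
    rw [hsgn v, hcomp v, Finset.mul_sum, Finset.sum_mul]
    refine Finset.sum_congr rfl fun x _ => ?_
    rw [hFP x v, Pi.add_apply, GowersCube.signChar_add]
    ring
  have hA : ∀ (x : Fin d → ZMod p) (μ : Fin ℓ → ZMod p),
      ‖∑ v, (GowersCube.signChar ((Qn + P x) v) * omega3 ^ wt v) * ZMod.stdAddChar (linPart μ v)‖ ≤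
        2 ^ ℓ * Real.exp (-(etaP p * ℓ / 4 ^ (s + 1))) :=
    fun x μ => norm_twisted_narrow_le hp3 (Submodule.add_mem _ hQn (hP x)) μ
  have h0 : ∀ v : Fin ℓ → Bool, (ZMod.stdAddChar (linPart (0 : Fin ℓ → ZMod p) v) : ℂ) = 1 := by
    intro v
    rw [show linPart (0 : Fin ℓ → ZMod p) v = 0 by simp [linPart], AddChar.map_zero_eq_one]
  have hx : ∀ x : Fin d → ZMod p,
      ‖∑ v, (GowersCube.signChar ((Qn + P x) v) * omega3 ^ wt v) * ∏ k, indC (Φ k) (x k) v‖ ≤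
        2 ^ ℓ * Real.exp (-(etaP p * ℓ / 4 ^ (s + 1))) := by
    intro x
    have h := norm_sum_mul_prod_indC_le _ (hA x) univ Φ x 0
    simp_rw [h0, mul_one] at h
    exact h
  have hp1 : (1 : ℝ) ≤ p := by exact_mod_cast (Fact.out : p.Prime).one_lt.le
  calc ‖∑ v, GowersCube.signChar (classPar c y a b r v) * omega3 ^ wt v‖
      = ‖∑ v : Fin ℓ → Bool, ∑ x : Fin d → ZMod p, (GowersCube.signChar ((Qn + P x) v) * omega3 ^ wt v) *
          ∏ k, indC (Φ k) (x k) v‖ := by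
        congr 1
        exact Finset.sum_congr rfl fun v _ => hpt v
    _ = ‖∑ x : Fin d → ZMod p, ∑ v : Fin ℓ → Bool, (GowersCube.signChar ((Qn + P x) v) * omega3 ^ wt v) *
          ∏ k, indC (Φ k) (x k) v‖ := by rw [Finset.sum_comm]
    _ ≤ ∑ x : Fin d → ZMod p, ‖∑ v : Fin ℓ → Bool, (GowersCube.signChar ((Qn + P x) v) * omega3 ^ wt v) *
          ∏ k, indC (Φ k) (x k) v‖ := norm_sum_le _ _
    _ ≤ ∑ _x : Fin d → ZMod p, 2 ^ ℓ * Real.exp (-(etaP p * ℓ / 4 ^ (s + 1))) :=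
        Finset.sum_le_sum fun x _ => hx x
    _ = (p : ℝ) ^ d * (2 ^ ℓ * Real.exp (-(etaP p * ℓ / 4 ^ (s + 1)))) := by
        rw [Finset.sum_const, Finset.card_univ, Fintype.card_fun, ZMod.card, Fintype.card_fin, nsmul_eq_mul]
        push_cast
        ring
    _ ≤ (p : ℝ) ^ D * (2 ^ ℓ * Real.exp (-(etaP p * ℓ / 4 ^ (s + 1)))) :=
        mul_le_mul_of_nonneg_right (pow_le_pow_right₀ hp1 hd) (by positivity)

/-- **PERTURB FIBRE THEOREM, absorbed** (`p ≠ 3`): `2·4^{s+1} ≤ M·η_p`, junta rank `≤ D` and `(p·D + 2)·M ≤ ℓ`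
⟹ `12·#WIN ≤ 11·2^ℓ` on every outside fibre. -/
theorem twelve_mul_win_fibre_le_jrank (hp3 : p ≠ 3)
    (hyl : ∀ g u, y g u = decide ((∑ i, if u i then lam g i else 0) = rr g)) (hgap : CutFree y L ℓ)
    {s M D : ℕ} (hM : 2 * 4 ^ (s + 1) ≤ (M : ℝ) * etaP p) (hJR : JRankLE p y lam s D)
    (hℓ : (p * D + 2) * M ≤ ℓ) (a : Fin L → Bool) (b : Fin R → Bool) :
    12 * (univ.filter fun v : Fin ℓ → Bool => ringWinU c y (glue3 a v b) = true).card ≤ 11 * 2 ^ ℓ := by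
  have hX : ∀ r : ℕ, ‖∑ v : Fin ℓ → Bool, GowersCube.signChar (classPar c y a b r v) * omega3 ^ wt v‖ ≤
      3 ^ (p * D) * (2 ^ ℓ * Real.exp (-(etaP p * ℓ / 4 ^ (s + 1)))) := fun r =>
    le_trans (norm_classSum_le_jrank c y lam rr hp3 hyl a b r hJR)
      (mul_le_mul_of_nonneg_right (pow_le_three_pow_mul (p := p) D) (by positivity))
  have h3 := three_mul_win_fibre_le_of_bound c y hgap a b hX
  have hE := mixed_err_absorb (etaP_pos (p := p)) (etaP_le_two p) hM hℓ
  have h : (12 : ℝ) * ((univ.filter fun v : Fin ℓ → Bool => ringWinU c y (glue3 a v b) = true).card : ℝ) ≤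
      11 * (2 : ℝ) ^ ℓ := by linarith
  exact_mod_cast h

end PerturbFibre

/-- **PERTURB WINDOW THEOREM** (Fubini over the outside fibres): `12·#WIN ≤ 11·2ⁿ`. -/
theorem window_bound_jrank {p : ℕ} [Fact p.Prime] (hp3 : p ≠ 3) (L ℓ R : ℕ) (c : ℕ)
    (y : Fin (L + ℓ + R + 1) → (Fin (L + ℓ + R) → Bool) → Bool)
    (lam : Fin (L + ℓ + R + 1) → Fin (L + ℓ + R) → ZMod p) (rr : Fin (L + ℓ + R + 1) → ZMod p)
    (hyl : ∀ g u, y g u = decide ((∑ i, if u i then lam g i else 0) = rr g)) (hgap : CutFree y L ℓ)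
    {s M D : ℕ} (hM : 2 * 4 ^ (s + 1) ≤ (M : ℝ) * etaP p) (hJR : JRankLE p y lam s D)
    (hℓ : (p * D + 2) * M ≤ ℓ) :
    12 * (univ.filter fun u : Fin (L + ℓ + R) → Bool => ringWinU c y u = true).card ≤ 11 * 2 ^ (L + ℓ + R) := by
  rw [card_filter_eq_sum_glue3 (fun w => ringWinU c y w = true), Finset.mul_sum]
  calc ∑ a : Fin L → Bool, 12 * ∑ b : Fin R → Bool,
        (univ.filter fun v : Fin ℓ → Bool => ringWinU c y (glue3 a v b) = true).card
      ≤ ∑ _a : Fin L → Bool, 2 ^ R * (11 * 2 ^ ℓ) := by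
        refine Finset.sum_le_sum fun a _ => ?_
        rw [Finset.mul_sum]
        calc ∑ b : Fin R → Bool, 12 * (univ.filter fun v : Fin ℓ → Bool => ringWinU c y (glue3 a v b) = true).card
            ≤ ∑ _b : Fin R → Bool, 11 * 2 ^ ℓ :=
              Finset.sum_le_sum fun b _ => twelve_mul_win_fibre_le_jrank c y lam rr hp3 hyl hgap hM hJR hℓ a b
          _ = 2 ^ R * (11 * 2 ^ ℓ) := by
            rw [Finset.sum_const, Finset.card_univ, Fintype.card_fun, Fintype.card_bool, Fintype.card_fin,
              smul_eq_mul]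
    _ = 2 ^ L * (2 ^ R * (11 * 2 ^ ℓ)) := by
        rw [Finset.sum_const, Finset.card_univ, Fintype.card_fun, Fintype.card_bool, Fintype.card_fin,
          smul_eq_mul]
    _ = 11 * 2 ^ (L + ℓ + R) := by rw [pow_add, pow_add]; ring

end Summit.QuantumAdvantage.QuantumAdvantage.Theorems.RankDial

end
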